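import Literature.MathematicalPhysics.QuantumFieldTheory.Balaban1983to89.Node00.OpsYDelta2Form

/-!
# `Balaban1983to89.B9C2LettersRealSymm` — [B9] (3.134) p. 422 with [B11] (56) p. 286 and [B7] pp. 20–21 ((22)–(23)): **THE SYMMETRIC REAL FORM LETTER
GENERATED BY RAW SECOND-ORDER DATA** — from any `U`-dependent family of `ℂ`-bilinear maps `raw(U) : (fine-bond fields)² → (index-bond functions)` the
letter `C2LettersY` whose form is the symmetrised, realified `raw(U)`: SYMMETRIC ([B11] (56)) and REAL (`form U A⋆ A′⋆ = (form U A A′)⋆`, the N06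
certificate's displayed `h𝔠real`) FOR EVERY `U` BY CONSTRUCTION, and EQUAL to `raw(U)` wherever `raw(U)` is already symmetric and real (the regime)

T. Bałaban, *Propagators for lattice gauge theories in a background field*, Commun. Math. Phys. **99** (1985) 389–434 [`Balaban1985BackgroundPropagators`,
"B9"]; [B11] = T. Bałaban, *The variational problem and background fields in renormalization group method for lattice gauge theories*, Commun. Math. Phys.
**102** (1985) 277–309 [`Balaban1985Variational`]; [B7] = T. Bałaban, *Averaging operations for lattice gauge theories*, Commun. Math. Phys. **98** (1985) 17–51
[`Balaban1985Averaging`].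
statement-level skeleton of published theorems with citation tags; proofs where landed; nothing here is a claim about the Yang–Mills mass gap.

THE PRINT.  [B9] (3.134) p. 422: *«Let us define ⟨A, Δ⁽²⁾A⟩ = 2⟨HC⁽²⁾(A), J⟩»* — a quadratic form in the `𝔤`-valued field `A`; [B11] p. 286 after (56): *«C_j⁽²⁾(A′, A″)
denotes a symmetric bilinear form obtained by polarization from the quadratic form C⁽²⁾(A′)»*; [B7] p. 20: *«The group G is obtained by applying the function
e^{iA} to A ∈ 𝔤»*, (22)–(23) p. 21 (the logarithm of a unitary is `i`·hermitian) — print's fields are `𝔤`-valued (REAL structure) and its second-order form is the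
SYMMETRIC polarisation of a quadratic form.  A `ℂ`-bilinear model `form U` of `C⁽²⁾(U; ·, ·)` (def-Y `Node00.OpsYDelta2Form.C2LettersY`) must therefore be
symmetric and real; the N06 certificate displays the second as `h𝔠real : ∀ x U, (U SU(N)-valued) → ∀ A A′, (𝔠 x).form U (star A) (star A′) = star ((𝔠 x).form U A A′)`
— for EVERY `U`, regular or not.

THE POINT (seat dag-n06-l g34, programme P-C2; memo `HOME/pub-ymgap-dag-n06-l/C2-INSTANCE-MEMO.md`).  The genuine raw datum — [B7]'s polarised `C_j⁽²⁾` read on the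
member torus (`B7Eq136SecondOrderPeriodic.torusPol` after the chart) — is symmetric and real only IN THE REGIME of [B7] Prop. 4 (`torusPol_symm`,
`B7Eq136SecondOrderSkewAdjoint.star_snd_fderiv_CCovIter_ins`: analyticity and unitarity are used), whereas `C2LettersY.symm` and `h𝔠real` are asked for ALL `U`.
THIS FILE removes the mismatch once and for all: `c2LettersOfRawY raw` symmetrises (`½(F + Fᵗ)`) and realifies (`½(G + G^σ)`, `G^σ(A, A′) := (G(A⋆, A′⋆))⋆`,
a `ℂ`-BILINEAR involution) the raw data, so both laws hold identically in `U`; where the raw form is already symmetric and real — the regime, the only place the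
certificate's `hC2` looks — the letter IS the raw form (`form_eq_raw`), and its entries obey the raw bounds (`norm_form_apply_le_of_symm`).

WHAT THIS FILE PROVES (0 sorry; definitions with bodies `symmPart`, `starConj`, `realPart`, `c2LettersOfRawY`; theorems).
* §1 `symmPart` (`½(F + Fᵗ)`), `symmPart_apply`, `symmPart_symm`, `symmPart_eq_self`.
* §2 `starConj` (`F^σ`), `starConj_apply`, `starConj_symm_of_symm`, `realPart` (`½(F + F^σ)`), `realPart_apply`, ★ `realPart_apply_star` (reality for every `F`),
  `realPart_eq_self`, `realPart_symm_of_symm`.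
* §3 ★★ `c2LettersOfRawY raw : C2LettersY 𝔸 i`, `c2LettersOfRawY_form`, ★★ `form_apply_star` (the displayed `h𝔠real` shape, EVERY `U`), ★ `form_eq_raw` (regime),
  ★ `norm_form_apply_le_of_symm` (entries: a star-invariant bound for the raw entries at a symmetric `raw U` bounds the letter's entries).
NOT CLAIMED: any raw datum (the chart file supplies `torusPol`); nothing of [B9]'s estimates.
-/

noncomputable section

namespace Literature.MathematicalPhysics.QuantumFieldTheory.Balaban1983to89.B9C2LettersRealSymm

open Node00 (CfgY FBondY IBondY C2LettersY)
open B6KLevelCensusIndexV1 (KIdx)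

/-! ## §1 Symmetrisation of a bilinear map -/

section Symm

variable {M P : Type*} [AddCommGroup M] [Module ℂ M] [AddCommGroup P] [Module ℂ P]

/-- the symmetric part `½(F + Fᵗ)` of a `ℂ`-bilinear map. [cite: Balaban1985Variational, (56) p.286 («symmetric bilinear form obtained by polarization»)] -/
def symmPart (F : M →ₗ[ℂ] M →ₗ[ℂ] P) : M →ₗ[ℂ] M →ₗ[ℂ] P := (2 : ℂ)⁻¹ • (F + F.flip)

/-- `½(F + Fᵗ)` evaluated. [cite: Balaban1985Variational, (56) p.286, bookkeeping] -/
theorem symmPart_apply (F : M →ₗ[ℂ] M →ₗ[ℂ] P) (A A' : M) : symmPart F A A' = (2 : ℂ)⁻¹ • (F A A' + F A' A) := by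
  simp [symmPart, LinearMap.flip_apply]

/-- the symmetric part is symmetric. [cite: Balaban1985Variational, (56) p.286] -/
theorem symmPart_symm (F : M →ₗ[ℂ] M →ₗ[ℂ] P) (A A' : M) : symmPart F A A' = symmPart F A' A := by
  rw [symmPart_apply, symmPart_apply, add_comm]

/-- a symmetric map is its own symmetric part. [cite: Balaban1985Variational, (56) p.286, bookkeeping] -/
theorem symmPart_eq_self {F : M →ₗ[ℂ] M →ₗ[ℂ] P} (hF : ∀ A A', F A A' = F A' A) : symmPart F = F := by
  ext A A'
  rw [symmPart_apply, ← hF A A', ← two_smul ℂ (F A A'), smul_smul, inv_mul_cancel₀ two_ne_zero, one_smul]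

end Symm

/-! ## §2 Realification: the involution `F^σ(A, A′) = (F(A⋆, A′⋆))⋆` and the real part `½(F + F^σ)` -/

section Real

variable {X Y : Type*} {𝔸 : Type*} [Ring 𝔸] [StarRing 𝔸] [Algebra ℂ 𝔸] [StarModule ℂ 𝔸]

/-- **the star-conjugate `F^σ`** of a `ℂ`-bilinear map between spaces of `𝔸`-valued functions: `F^σ(A, A′) := (F(A⋆, A′⋆))⋆` — `ℂ`-bilinear again (two
conjugate-linear operations). [cite: Balaban1985Averaging, (22)–(23) p.21, p.20 («A ∈ 𝔤»), bookkeeping] -/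
def starConj (F : (X → 𝔸) →ₗ[ℂ] (X → 𝔸) →ₗ[ℂ] (Y → 𝔸)) : (X → 𝔸) →ₗ[ℂ] (X → 𝔸) →ₗ[ℂ] (Y → 𝔸) :=
  LinearMap.mk₂ ℂ (fun A A' => star (F (star A) (star A')))
    (fun A B A' => by simp only [star_add, map_add, LinearMap.add_apply])
    (fun c A A' => by simp only [star_smul, map_smul, LinearMap.smul_apply, star_star])
    (fun A A' B' => by simp only [star_add, map_add])
    (fun c A A' => by simp only [star_smul, map_smul, star_star])

/-- `F^σ` evaluated. [cite: Balaban1985Averaging, (22)–(23) p.21, bookkeeping] -/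
@[simp] theorem starConj_apply (F : (X → 𝔸) →ₗ[ℂ] (X → 𝔸) →ₗ[ℂ] (Y → 𝔸)) (A A' : X → 𝔸) :
    starConj F A A' = star (F (star A) (star A')) := rfl

/-- `F^σ` is symmetric when `F` is. [cite: Balaban1985Variational, (56) p.286, bookkeeping] -/
theorem starConj_symm_of_symm {F : (X → 𝔸) →ₗ[ℂ] (X → 𝔸) →ₗ[ℂ] (Y → 𝔸)} (hF : ∀ A A', F A A' = F A' A) (A A' : X → 𝔸) :
    starConj F A A' = starConj F A' A := by
  rw [starConj_apply, starConj_apply, hF]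

/-- **the real part `½(F + F^σ)`**. [cite: Balaban1985Averaging, p.20 («A ∈ 𝔤»), (22)–(23) p.21] -/
def realPart (F : (X → 𝔸) →ₗ[ℂ] (X → 𝔸) →ₗ[ℂ] (Y → 𝔸)) : (X → 𝔸) →ₗ[ℂ] (X → 𝔸) →ₗ[ℂ] (Y → 𝔸) := (2 : ℂ)⁻¹ • (F + starConj F)

/-- `½(F + F^σ)` evaluated. [cite: Balaban1985Averaging, (22)–(23) p.21, bookkeeping] -/
theorem realPart_apply (F : (X → 𝔸) →ₗ[ℂ] (X → 𝔸) →ₗ[ℂ] (Y → 𝔸)) (A A' : X → 𝔸) :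
    realPart F A A' = (2 : ℂ)⁻¹ • (F A A' + star (F (star A) (star A'))) := by
  simp [realPart]

/-- ★ **THE REAL PART IS REAL, FOR EVERY `F`**: `½(F + F^σ)(A⋆, A′⋆) = (½(F + F^σ)(A, A′))⋆`. [cite: Balaban1985Averaging, p.20 («A ∈ 𝔤»), (22)–(23) p.21] -/
theorem realPart_apply_star (F : (X → 𝔸) →ₗ[ℂ] (X → 𝔸) →ₗ[ℂ] (Y → 𝔸)) (A A' : X → 𝔸) :
    realPart F (star A) (star A') = star (realPart F A A') := by
  rw [realPart_apply, realPart_apply, star_star, star_star, star_smul, star_add, star_star, add_comm (star (F A A'))]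
  congr 1
  rw [Complex.star_def, map_inv₀, map_ofNat]

/-- a real map is its own real part. [cite: Balaban1985Averaging, (22)–(23) p.21, bookkeeping] -/
theorem realPart_eq_self {F : (X → 𝔸) →ₗ[ℂ] (X → 𝔸) →ₗ[ℂ] (Y → 𝔸)} (hF : ∀ A A', F (star A) (star A') = star (F A A')) :
    realPart F = F := by
  ext A A'
  rw [realPart_apply, hF, star_star, ← two_smul ℂ (F A A'), smul_smul, inv_mul_cancel₀ two_ne_zero, one_smul]

/-- the real part of a symmetric map is symmetric. [cite: Balaban1985Variational, (56) p.286, bookkeeping] -/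
theorem realPart_symm_of_symm {F : (X → 𝔸) →ₗ[ℂ] (X → 𝔸) →ₗ[ℂ] (Y → 𝔸)} (hF : ∀ A A', F A A' = F A' A) (A A' : X → 𝔸) :
    realPart F A A' = realPart F A' A := by
  rw [realPart_apply, realPart_apply, hF A A', hF (star A) (star A')]

end Real

/-! ## §3 The letter `C2LettersY` generated by raw data: symmetric and real for every `U`, equal to the raw form in the regime -/

section Letters

variable {d ℓ : ℕ} {hd : 1 ≤ d + 1} {hL : Odd (ℓ + 1) ∧ 1 < ℓ + 1} {b₀ b₁ : ℝ}
variable {𝔸 : Type} [NormedRing 𝔸] [NormedAlgebra ℂ 𝔸] [CompleteSpace 𝔸] [StarRing 𝔸] [StarModule ℂ 𝔸]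
variable (i : KIdx d ℓ hd hL b₀ b₁)

/-- ★★ **THE LETTER GENERATED BY RAW SECOND-ORDER DATA**: `form U := ½(G + G^σ)`, `G := ½(raw U + (raw U)ᵗ)` — a `C2LettersY` (symmetric for every `U`).
[cite: Balaban1985BackgroundPropagators, (3.134) p.422] [cite: Balaban1985Variational, (56) p.286] [cite: Balaban1985Averaging, (22)–(23) p.21] -/
def c2LettersOfRawY (raw : CfgY 𝔸 i → (FBondY i → 𝔸) →ₗ[ℂ] (FBondY i → 𝔸) →ₗ[ℂ] (IBondY i → 𝔸)) : C2LettersY 𝔸 i :=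
  ⟨fun U => realPart (symmPart (raw U)), fun U A A' => realPart_symm_of_symm (symmPart_symm (raw U)) A A'⟩

/-- the form of the generated letter. [cite: Balaban1985BackgroundPropagators, (3.134) p.422, bookkeeping] -/
theorem c2LettersOfRawY_form (raw : CfgY 𝔸 i → (FBondY i → 𝔸) →ₗ[ℂ] (FBondY i → 𝔸) →ₗ[ℂ] (IBondY i → 𝔸)) (U : CfgY 𝔸 i) :
    (c2LettersOfRawY i raw).form U = realPart (symmPart (raw U)) := rfl

/-- ★★ **REALITY FOR EVERY `U`** — the N06 certificate's displayed `h𝔠real` shape, by construction: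
`form U (star A) (star A′) = star (form U A A′)`. [cite: Balaban1985Averaging, p.20 («A ∈ 𝔤»), (22)–(23) p.21] [cite: Balaban1985BackgroundPropagators, (3.134) p.422] -/
theorem form_apply_star (raw : CfgY 𝔸 i → (FBondY i → 𝔸) →ₗ[ℂ] (FBondY i → 𝔸) →ₗ[ℂ] (IBondY i → 𝔸)) (U : CfgY 𝔸 i)
    (A A' : FBondY i → 𝔸) : (c2LettersOfRawY i raw).form U (star A) (star A') = star ((c2LettersOfRawY i raw).form U A A') :=
  realPart_apply_star _ A A'

/-- ★ **IN THE REGIME THE LETTER IS THE RAW FORM**: if `raw U` is symmetric and real then `form U = raw U`.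
[cite: Balaban1985Variational, (56) p.286] [cite: Balaban1985Averaging, (22)–(23) p.21] -/
theorem form_eq_raw (raw : CfgY 𝔸 i → (FBondY i → 𝔸) →ₗ[ℂ] (FBondY i → 𝔸) →ₗ[ℂ] (IBondY i → 𝔸)) {U : CfgY 𝔸 i}
    (hs : ∀ A A', raw U A A' = raw U A' A) (hr : ∀ A A', raw U (star A) (star A') = star (raw U A A')) :
    (c2LettersOfRawY i raw).form U = raw U := by
  rw [c2LettersOfRawY_form, symmPart_eq_self hs, realPart_eq_self hr]

/-- at a symmetric `raw U` the letter's entries are averages of two raw entries: `form U A A′ = ½(raw U A A′ + (raw U A⋆ A′⋆)⋆)`.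
[cite: Balaban1985Variational, (56) p.286, bookkeeping] -/
theorem form_apply_of_symm (raw : CfgY 𝔸 i → (FBondY i → 𝔸) →ₗ[ℂ] (FBondY i → 𝔸) →ₗ[ℂ] (IBondY i → 𝔸)) {U : CfgY 𝔸 i}
    (hs : ∀ A A', raw U A A' = raw U A' A) (A A' : FBondY i → 𝔸) :
    (c2LettersOfRawY i raw).form U A A' = (2 : ℂ)⁻¹ • (raw U A A' + star (raw U (star A) (star A'))) := by
  rw [c2LettersOfRawY_form, symmPart_eq_self hs, realPart_apply]

variable [NormedStarGroup 𝔸]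

/-- ★ **ENTRIES AT A SYMMETRIC RAW DATUM**: a bound for the raw entries that is invariant under `(A, A′) ↦ (A⋆, A′⋆)` bounds the letter's entries
(`‖x⋆‖ = ‖x‖`). [cite: Balaban1985Averaging, (149) p.40, (22)–(23) p.21, bookkeeping] [cite: Balaban1985Variational, (56) p.286] -/
theorem norm_form_apply_le_of_symm (raw : CfgY 𝔸 i → (FBondY i → 𝔸) →ₗ[ℂ] (FBondY i → 𝔸) →ₗ[ℂ] (IBondY i → 𝔸)) {U : CfgY 𝔸 i}
    (hs : ∀ A A', raw U A A' = raw U A' A) {A A' : FBondY i → 𝔸} {c : IBondY i} {β : ℝ}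
    (h₁ : ‖raw U A A' c‖ ≤ β) (h₂ : ‖raw U (star A) (star A') c‖ ≤ β) :
    ‖(c2LettersOfRawY i raw).form U A A' c‖ ≤ β := by
  rw [form_apply_of_symm i raw hs, Pi.smul_apply, Pi.add_apply, Pi.star_apply, norm_smul, norm_inv, Complex.norm_ofNat]
  have h3 : ‖star (raw U (star A) (star A') c)‖ ≤ β := by rw [norm_star]; exact h₂
  have h4 := (norm_add_le _ _).trans (add_le_add h₁ h3)
  have : (0 : ℝ) < 2 := two_pos
  calc 2⁻¹ * ‖raw U A A' c + star (raw U (star A) (star A') c)‖ ≤ 2⁻¹ * (β + β) := by gcongr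
    _ = β := by ring

end Letters

end Literature.MathematicalPhysics.QuantumFieldTheory.Balaban1983to89.B9C2LettersRealSymm
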